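import Literature.NumberTheory.Automorphic.QuaternionCoordOrderProofs
import HarnessLib

/-!
# Norm-one quaternions satisfying integral linear conditions: a local–global principle from
# Kneser's strong approximation theorem

Topic `NumberTheory/Automorphic`; theorems only (no definition, no named fact, no instance).
Let `K` be a number field, `a, b ∈ 𝓞 K ∖ 0` with `ℍ = ℍ[K,a,b]` not totally definite, and let
`ℓ₁, …, ℓ₄` be `K`-linear forms in the four coordinates `(x₀, x₁, x₂, x₃)` of `x ∈ ℍ`, given
by a matrix `Q ∈ M₄(K)`: `ℓ_i(x) = ∑_j Q_ij x_j` (think of the coefficient functionals of a full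
`𝓞 K`-lattice `L = {x : ℓ_i(x) ∈ 𝓞 K}`). Suppose that

* for every finite place `v` in a finite set `S` there is `y_v ∈ ℍ[K_v,a,b]` with `y_v ȳ_v = 1`
  and `ℓ_i(y_v) ∈ 𝒪_v` for all `i` (a local norm-one point of `L_v`), and
* `Q` has `v`-integral entries at the places `v ∉ S` (so `1 ∈ L_v` there).

Then there is a global `x ∈ ℍ` with `x x̄ = 1` and `ℓ_i(x) ∈ 𝓞 K` for all `i` — a norm-one
element of `L` (`exists_mul_star_eq_one_forall_linear_mem`). Proof: Kneser's strong
approximation theorem in its finite-adelic coordinate form (`finiteAdele_dense`,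
`QuaternionCoordOrderProofs.lean`; Vignéras, LNM 800, Ch. III §4 Thm. 4.3 with `S = ∞`)
approximates the norm-one finite-adelic quaternion `Y = (y_v at v ∈ S, 1 elsewhere)` by a global
norm-one `x` with `x - Y ∈ N 𝒪̂_K` coordinatewise, `N ∈ 𝓞 K ∖ 0` a common denominator of `Q`;
then `ℓ_i(x) - ℓ_i(Y_w) ∈ 𝒪_w` at every place `w`, `ℓ_i(Y_w) ∈ 𝒪_w` by hypothesis, and an element
of `K` integral at all finite places lies in `𝓞 K` (Vignéras III §5 A Prop. 5.1,
`X_K = K ∩ X_A`). This is the form of strong approximation used to show that locally principal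
ideals of Eichler orders in indefinite quaternion algebras are principal (Eichler; Vignéras III
§5 Cor. 5.7 (2)), on the way to `Literature.NumberTheory.Automorphic.ShimuraCurveData.volume_fd_eq`.

## References

* M.-F. Vignéras, *Arithmétique des algèbres de quaternions*, LNM 800 (1980), Ch. III §4
  Thm. 4.3, §5 A Prop. 5.1 and Cor. 5.7 [VignerasLNM800].
-/

open NumberField IsDedekindDomain

namespace Literature.NumberTheory.Automorphic

namespace QuaternionAlgebra

/-- `ℍ⟮K; R; a, b⟯ := ℍ[K, algebraMap R K a, algebraMap R K b]` (file-local notation, as in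
`QuaternionCoordOrder`). -/
local notation "ℍ⟮" K "; " R "; " a ", " b "⟯" =>
  QuaternionAlgebra K (algebraMap R K a) (0 : K) (algebraMap R K b)

variable {K : Type} [Field K] [NumberField K] (a b : 𝓞 K)

/-- `𝔸_K^∞`. -/
local notation "𝔸ᶠ" => FiniteAdeleRing (𝓞 K) K

/-- `K_w`. -/
local notation "K_" w => HeightOneSpectrum.adicCompletion K w

/-- `𝒪_w`. -/
local notation "𝒪_" w => HeightOneSpectrum.adicCompletionIntegers K w

/-! ### Finite sums of finite adeles, componentwise -/

/-- Components of a finite sum of finite adeles. [folklore] -/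
theorem finiteAdele_sum_apply {ι : Type*} (s : Finset ι) (g : ι → 𝔸ᶠ)
    (w : HeightOneSpectrum (𝓞 K)) : (∑ i ∈ s, g i) w = ∑ i ∈ s, g i w := by
  classical
  induction s using Finset.induction_on with
  | empty => simp [FiniteAdeleRing.zero_apply']
  | insert i s hi ih => rw [Finset.sum_insert hi, Finset.sum_insert hi, FiniteAdeleRing.add_apply', ih]

open scoped Classical in
/-- **A finite adele with prescribed components on a finite set of places**: for `S` finite,
local data `c_v ∈ K_v` (`v ∈ S`) and a base value `e ∈ K`, the finite adele
`e + ∑_{v ∈ S} (c_v - e)δ_v` has component `c_w` at `w ∈ S` and `e` at `w ∉ S`. [folklore] -/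
theorem prescribed_apply (S : Finset (HeightOneSpectrum (𝓞 K))) (e : K)
    (c : ∀ v : HeightOneSpectrum (𝓞 K), K_ v) (w : HeightOneSpectrum (𝓞 K)) :
    (algebraMap K 𝔸ᶠ e + ∑ v ∈ S, finiteAdeleSingleHom K v (c v - algebraMap K (K_ v) e)) w =
      if w ∈ S then c w else algebraMap K (K_ w) e := by
  classical
  rw [FiniteAdeleRing.add_apply', finiteAdele_sum_apply, algebraMap_finiteAdele_apply]
  by_cases hw : w ∈ S
  · rw [if_pos hw, Finset.sum_eq_single w]
    · rw [finiteAdeleSingleHom_apply_self]; abel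
    · intro v _ hvw
      exact finiteAdeleSingleHom_apply_of_ne K v _ hvw.symm
    · intro h; exact absurd hw h
  · rw [if_neg hw, Finset.sum_eq_zero, add_zero]
    intro v hv
    exact finiteAdeleSingleHom_apply_of_ne K v _ (fun h => hw (h ▸ hv))

/-! ### The local–global principle for norm-one points of a lattice -/

/-- **Norm-one quaternions satisfying integral linear conditions, from `SA_f`.** Let `Q ∈ M₄(K)`
define linear forms `ℓ_i(x) = ∑_j Q_ij x_j` in the coordinates of `ℍ[K,a,b]`, `v`-integral at
the places outside a finite set `S`, and suppose given at each `v ∈ S` a norm-one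
`y_v ∈ ℍ[K_v,a,b]` with `ℓ_i(y_v) ∈ 𝒪_v` for all `i`. If `ℍ¹` is dense in `ℍ[𝔸_K^∞,a,b]¹`
(Kneser's theorem in coordinates, `SA_f`), then some `x ∈ ℍ[K,a,b]` with `x x̄ = 1` has
`ℓ_i(x) ∈ 𝓞 K` for all `i`. [cite: VignerasLNM800, Ch. III §4 Thm. 4.3 and §5 A Prop. 5.1] -/
theorem exists_mul_star_eq_one_forall_linear_mem_of_finiteAdele_dense
    (hSA : ∀ y : ℍ⟮𝔸ᶠ; 𝓞 K; a, b⟯, y * star y = 1 →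
      ∀ V : Set 𝔸ᶠ, IsOpen V → (0 : 𝔸ᶠ) ∈ V →
        ∃ x : ℍ⟮K; 𝓞 K; a, b⟯, x * star x = 1 ∧ algebraMap K 𝔸ᶠ x.re - y.re ∈ V ∧
          algebraMap K 𝔸ᶠ x.imI - y.imI ∈ V ∧ algebraMap K 𝔸ᶠ x.imJ - y.imJ ∈ V ∧
          algebraMap K 𝔸ᶠ x.imK - y.imK ∈ V)
    (S : Finset (HeightOneSpectrum (𝓞 K))) (Q : Fin 4 → Fin 4 → K) (N : 𝓞 K) (hN : N ≠ 0)
    (hQN : ∀ i j, ∃ r : 𝓞 K, algebraMap (𝓞 K) K r = (algebraMap (𝓞 K) K N) * Q i j)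
    (hQS : ∀ v, v ∉ S → ∀ i j, algebraMap K (K_ v) (Q i j) ∈ 𝒪_ v)
    (y : ∀ v : HeightOneSpectrum (𝓞 K),
      ℍ⟮K_ v; 𝒪_ v; algebraMap (𝓞 K) (𝒪_ v) a, algebraMap (𝓞 K) (𝒪_ v) b⟯)
    (hy1 : ∀ v ∈ S, y v * star (y v) = 1)
    (hyL : ∀ v ∈ S, ∀ i, ∑ j, algebraMap K (K_ v) (Q i j) *
      ![(y v).re, (y v).imI, (y v).imJ, (y v).imK] j ∈ 𝒪_ v) :
    ∃ x : ℍ⟮K; 𝓞 K; a, b⟯, x * star x = 1 ∧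
      ∀ i, ∃ r : 𝓞 K, algebraMap (𝓞 K) K r = ∑ j, Q i j * ![x.re, x.imI, x.imJ, x.imK] j := by
  classical
  -- the finite adele with components `y_v` (`v ∈ S`) and `1` elsewhere
  set base : Fin 4 → K := ![1, 0, 0, 0] with hbase
  set cy : ∀ v : HeightOneSpectrum (𝓞 K), Fin 4 → K_ v :=
    fun v => ![(y v).re, (y v).imI, (y v).imJ, (y v).imK] with hcy
  set f : Fin 4 → 𝔸ᶠ := fun k => algebraMap K 𝔸ᶠ (base k) +
    ∑ v ∈ S, finiteAdeleSingleHom K v (cy v k - algebraMap K (K_ v) (base k)) with hf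
  have hfapp : ∀ k w, f k w = if w ∈ S then cy w k else algebraMap K (K_ w) (base k) :=
    fun k w => prescribed_apply S (base k) (fun v => cy v k) w
  set Y : ℍ⟮𝔸ᶠ; 𝓞 K; a, b⟯ := ⟨f 0, f 1, f 2, f 3⟩ with hY
  -- `Y Ȳ = 1`
  have hY1 : Y * star Y = 1 := by
    rw [mul_star_eq_one_iff_coords]
    refine FiniteAdeleRing.ext K fun w => ?_
    simp only [hY, pow_two, FiniteAdeleRing.mul_apply', FiniteAdeleRing.sub_apply',
      FiniteAdeleRing.add_apply', FiniteAdeleRing.coe_one_apply, algebraMap_integers_finiteAdele_apply,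
      hfapp]
    by_cases hw : w ∈ S
    · simp only [if_pos hw]
      have h := (mul_star_eq_one_iff_coords (y w)).mp (hy1 w hw)
      simp only [hcy, Matrix.cons_val_zero, Matrix.cons_val_one, Matrix.head_cons,
        Matrix.cons_val_two, Matrix.tail_cons, Matrix.cons_val_three, pow_two] at h ⊢
      exact h
    · simp only [if_neg hw, hbase, Matrix.cons_val_zero, Matrix.cons_val_one, Matrix.head_cons,
        Matrix.cons_val_two, Matrix.tail_cons, Matrix.cons_val_three, map_one, map_zero]
      ring
  -- the open box `N 𝒪̂`
  set Ninv : 𝔸ᶠ := algebraMap K 𝔸ᶠ (algebraMap (𝓞 K) K N)⁻¹ with hNinv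
  set V : Set 𝔸ᶠ := {t | Ninv * t ∈ integralFiniteAdeles K} with hV
  have hVopen : IsOpen V :=
    (isOpen_integralFiniteAdeles K).preimage (continuous_const.mul continuous_id)
  have hV0 : (0 : 𝔸ᶠ) ∈ V := by
    change Ninv * 0 ∈ integralFiniteAdeles K
    rw [mul_zero]; exact zero_mem _
  obtain ⟨x, hx1, h₀, h₁, h₂, h₃⟩ := hSA Y hY1 V hVopen hV0
  refine ⟨x, hx1, fun i => ?_⟩
  -- integrality of `ℓ_i(x)` at every finite place
  set cx : Fin 4 → K := ![x.re, x.imI, x.imJ, x.imK] with hcx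
  have hdiff : ∀ k w, algebraMap K (K_ w) (algebraMap (𝓞 K) K N)⁻¹ *
      (algebraMap K (K_ w) (cx k) - f k w) ∈ 𝒪_ w := by
    intro k w
    have hk : algebraMap K 𝔸ᶠ (cx k) - f k ∈ V := by
      fin_cases k
      · simpa [hcx, hY] using h₀
      · simpa [hcx, hY] using h₁
      · simpa [hcx, hY] using h₂
      · simpa [hcx, hY] using h₃
    have h := hk w
    rw [FiniteAdeleRing.mul_apply', FiniteAdeleRing.sub_apply', hNinv, algebraMap_finiteAdele_apply,
      algebraMap_finiteAdele_apply] at h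
    exact h
  apply exists_algebraMap_eq_of_forall_coe_mem (𝓞 K) K
  intro w
  rw [adicCompletion_coe_eq_algebraMap, map_sum]
  simp_rw [map_mul]
  -- split `x_j = Y_j(w) + N · (N⁻¹ (x_j - Y_j(w)))`
  have hNw : algebraMap K (K_ w) (algebraMap (𝓞 K) K N) ≠ 0 := by
    rw [map_ne_zero_iff _ (algebraMap K (K_ w)).injective]
    exact (map_ne_zero_iff _ (FaithfulSMul.algebraMap_injective (𝓞 K) K)).mpr hN
  have hsplit : ∀ j, algebraMap K (K_ w) (cx j) = f j w + algebraMap K (K_ w) (algebraMap (𝓞 K) K N) *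
      (algebraMap K (K_ w) (algebraMap (𝓞 K) K N)⁻¹ * (algebraMap K (K_ w) (cx j) - f j w)) := by
    intro j
    rw [map_inv₀, ← mul_assoc, mul_inv_cancel₀ hNw, one_mul, add_sub_cancel]
  have hsum : ∑ j, algebraMap K (K_ w) (Q i j) * algebraMap K (K_ w) (cx j) =
      (∑ j, algebraMap K (K_ w) (Q i j) * f j w) +
        ∑ j, (algebraMap K (K_ w) (algebraMap (𝓞 K) K N) * algebraMap K (K_ w) (Q i j)) *
          (algebraMap K (K_ w) (algebraMap (𝓞 K) K N)⁻¹ * (algebraMap K (K_ w) (cx j) - f j w)) := by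
    rw [← Finset.sum_add_distrib]
    refine Finset.sum_congr rfl fun j _ => ?_
    conv_lhs => rw [hsplit j]
    ring
  rw [hsum]
  refine add_mem ?_ (sum_mem fun j _ => mul_mem ?_ (hdiff j w))
  · -- `ℓ_i(Y_w) ∈ 𝒪_w`
    by_cases hw : w ∈ S
    · have h := hyL w hw i
      simp_rw [hfapp, if_pos hw]
      exact h
    · simp_rw [hfapp, if_neg hw]
      rw [Fin.sum_univ_four]
      simp only [hbase, Matrix.cons_val_zero, Matrix.cons_val_one, Matrix.head_cons,
        Matrix.cons_val_two, Matrix.tail_cons, Matrix.cons_val_three, map_one, map_zero,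
        mul_one, mul_zero, add_zero]
      exact hQS w hw i 0
  · -- `N Q_ij ∈ 𝒪_w`
    obtain ⟨r, hr⟩ := hQN i j
    rw [← map_mul, ← hr, ← adicCompletion_coe_eq_algebraMap]
    exact HeightOneSpectrum.coe_mem_adicCompletionIntegers w r

/-- **Norm-one quaternions satisfying integral linear conditions** (Kneser's strong approximation
theorem, Vignéras III §4 Thm. 4.3, in the local–global form of III §5 Prop. 5.1 / Cor. 5.7):
for `a, b ∈ 𝓞 K ∖ 0` with `ℍ[K,a,b]` not totally definite, linear forms `ℓ_i = ∑_j Q_ij x_j`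
integral outside a finite set `S` of places, and norm-one local solutions `y_v ∈ ℍ[K_v,a,b]`,
`ℓ_i(y_v) ∈ 𝒪_v`, at the places `v ∈ S`, there is a global `x ∈ ℍ[K,a,b]` with `x x̄ = 1` and
`ℓ_i(x) ∈ 𝓞 K` for all `i`. [cite: VignerasLNM800, Ch. III §4 Thm. 4.3 and §5 Cor. 5.7] -/
theorem exists_mul_star_eq_one_forall_linear_mem (ha : a ≠ 0) (hb : b ≠ 0)
    (hdef : ¬ IsTotallyDefinite K ℍ⟮K; 𝓞 K; a, b⟯)
    (S : Finset (HeightOneSpectrum (𝓞 K))) (Q : Fin 4 → Fin 4 → K) (N : 𝓞 K) (hN : N ≠ 0)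
    (hQN : ∀ i j, ∃ r : 𝓞 K, algebraMap (𝓞 K) K r = (algebraMap (𝓞 K) K N) * Q i j)
    (hQS : ∀ v, v ∉ S → ∀ i j, algebraMap K (K_ v) (Q i j) ∈ 𝒪_ v)
    (y : ∀ v : HeightOneSpectrum (𝓞 K),
      ℍ⟮K_ v; 𝒪_ v; algebraMap (𝓞 K) (𝒪_ v) a, algebraMap (𝓞 K) (𝒪_ v) b⟯)
    (hy1 : ∀ v ∈ S, y v * star (y v) = 1)
    (hyL : ∀ v ∈ S, ∀ i, ∑ j, algebraMap K (K_ v) (Q i j) *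
      ![(y v).re, (y v).imI, (y v).imJ, (y v).imK] j ∈ 𝒪_ v) :
    ∃ x : ℍ⟮K; 𝓞 K; a, b⟯, x * star x = 1 ∧
      ∀ i, ∃ r : 𝓞 K, algebraMap (𝓞 K) K r = ∑ j, Q i j * ![x.re, x.imI, x.imJ, x.imK] j :=
  exists_mul_star_eq_one_forall_linear_mem_of_finiteAdele_dense a b (finiteAdele_dense a b ha hb hdef)
    S Q N hN hQN hQS y hy1 hyL

end QuaternionAlgebra

end Literature.NumberTheory.Automorphic
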